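import Summits.BirchSwinnertonDyer.Rank1Residual.F1Sign2.KuriharaLevelVanishingAtTwo
import Literature.NumberTheory.EllipticCurves.MazurRubin2010.TwistSelmerRankControl
import Literature.NumberTheory.EllipticCurves.BSDRootNumberSmallConductorProofs
import Literature.NumberTheory.EllipticCurves.KuriharaNumberParityProofs
import Literature.NumberTheory.EllipticCurves.PAdicLFunctionIntegralityAtTwoProofs
import Mathlib.NumberTheory.Padics.PadicNumbers
import HarnessLib

/-!
# The square (tame-height) law for first-layer Kurihara numbers at two — K2-F♯
(cell bsd-f1-sign2, seat -es, gen 3; landing part 5 of `data-es/landing/`, imports part 2;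
statements + two kernel-checked logic lemmas, 0 sorry; joint check `JointG7.lean` rc 0, axioms
[propext, Classical.choice, Quot.sound])

K2-F (part 2, `FirstLayerLawAtTwo`) says: on Kim's class in rank one the first Kolyvagin layer at `2`
computes `#Ш[2^∞] = 2^s` — every first-layer Kurihara number is divisible by `2^{min(k,s+1)}` (a) and
some deep one has valuation exactly `s+1` (b).  DES9-v1 showed MORE: the offset `v₂ δ'_k(ℓ) − (s+1)`
is never odd (0/6 782 rows, 2 877 deep enough) and the level histograms follow `P(offset = 2j) =
2^{-(j+1)}`.  K2-F♯ (`SquareLawAtTwo`) names the law: **`v₂(δ'_k(ℓ;ψ) mod 2^k) = min(k, s + 1 +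
2·d_ℓ(P))`** where `P` generates `E(ℚ)` modulo torsion up to odd index and `d_ℓ(P)` is the
`2`-divisibility depth of `P` in `E(ℚ_ℓ)` (= of `P̃` in the cyclic group `Ẽ(𝔽_ℓ)[2^∞]`) — typed through
`LocallyTwoPowDivisible W ℓ j P := ∃ Q ∈ E(ℚ_ℓ), 2^j Q = P`.

DES10 (kit `des10-full2` j288175, tag bsd-frontier-data, `--workitem stmt-BirchSwinnertonDyer-19097`;
engine 1 Sage `GF(ℓ)` group law on a `2`-saturated PARI `ellheegner` generator, engine 2 PARI
`ellcard`/`ellorder`; observed valuations = DES9-v1, eclib exact modular symbols): ROW-LEVEL test,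
tolerance zero — see the numbers in the docstring of `SquareLawAtTwo` and `data-es/des10/SUMMARY10-full.txt`.

Kernel-checked reductions (pure logic): `firstLayerLawAtTwo_of_squareLaw : SquareLawAtTwo →
KummerPrimeAtTwo → TwoSaturatedPointAtTwo → FirstLayerLawAtTwo` and its analytic twin; with part 4
(`bsdp_two_of_firstLayerLaws`) the square laws therefore reach `BSDp W 2` on Kim's class in rank one
given Kummer primes (Chebotarev), a `2`-saturated point (Mordell–Weil), GZK and `Ш[2^∞]` finite.

MECHANISM (heuristic; each input is printed for ODD `p` only — Kato's reciprocity law for derivative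
classes, Kolyvagin's `loc^s_ℓ κ_ℓ = φ^{fs}_ℓ(loc_ℓ κ_1)`, Poitou–Tate, `κ_1 = t·P` in rank one): `δ_ℓ ≐
t β_ℓ c_ℓ(P)² / c_p(P)`, the local Kummer coordinate of `P` at `ℓ` entering SQUARED; equivalently the
prime-level, rank-one case of Mazur–Tate's refined conjecture (Duke 1987, Conj. 4) read `2`-adically,
`θ'_ℓ ≐ #Ш · ⟨P,P⟩^{MT}_ℓ`.  NOVELTY (search-before-claim, corpus + galaxy, -ref2 v8–v10): nothing at
`p = 2` in print (Kim arXiv:2203.12159 `p ≥ 5`; Sakamoto `p = 3`); the individual-`δ_ℓ` valuation law is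
not stated in the held texts for any `p` (Kurihara arXiv:1407.2465 Thm 1.2.2 / Conj. 1.2.1 give minima
`n_i` over layers, not `δ_ℓ` prime by prime) — placement of the odd-`p` square law is an ask to -ref2
(Mazur–Tate 1987 §3; Bertolini–Darmon, Duke 76 (1994) derived heights; Ota 2018; Kurihara 2014b).

REF2-PLACEMENT-v12 (70d4e63c0ee24f14) §0/§1 (2026-08-27T19:47:55Z): K2-F♯ `SquareLawAtTwo` is NOVEL-AS-STATED at `2`;
P-ODD-ONLY and there only as ASSEMBLY (p ≥ 5: Mazur–Rubin 2004 + Kim 2022 + Kurihara's reciprocity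
[arxiv-1407.2465 p0003 L140] + BSD_p); the per-`ℓ` valuation sentence «ord δ̃_ℓ = s + 2d_ℓ(P)» is printed at NO `p`
(Kurihara 2014b prints the valuation-0 case Thm 1.2.3/1.2.5, Conj 1.2.4; Kim 2022/2022b the min/∂ laws; the
Mazur–Tate / regulator family EXCLUDES Kurihara primes by hypothesis: BD94 Conj 4.6 Rem. 1, BKS19 Conj 1.1/Thm 1.3(d),
BKS25 Hyp 2.2(iii)); conjecture habitat Mazur–Tate 1987 Conj. 4 (cite-only, acq-02631); currency = K2-F (yes-modest), no
new currency. `AnalyticSquareLawAtTwo`: as K2-F♯ (data form). `KummerPrimeAtTwo`: IN-PRINT-ASSEMBLY routine (Kummer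
theory of non-CM curves, Bashmakov/Ribet + Chebotarev). `TwoSaturatedPointAtTwo`: THEOREM, trivial given Mordell–Weil.

TYPER FILING (seat `bsd-f1-sign2-ty` g2; CANDIDATES.md rows ES-K2-F♯ / ES-K2-F♯an / ES-KUM / ES-2SAT): part 5 of the
-es landing kit `HOME/data-es/landing/SquareLawAtTwo.lean` c46e32cb76c749f2 (-es g3; standalone `lean check` against the
tree rc 0, 0 warnings; BC7 CLEAN ×4 vs `RankOneAtTwo`, `data-es/landing/ProbeG7-verdicts.txt` 94d0fc3d2301b7a5) re-filed
with all bodies VERBATIM; the two supports carry the «support (…)» docstring label of part 2's `FrickeReflectionAtPrimeLevel`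
(plain `def`s = hypotheses threaded explicitly through the glue theorems, not asserted). STATEMENTS ONLY + two
kernel-checked logic lemmas; nothing asserted, no named fact. REF1-AUDIT-v1 §28 (5615ef40d6a2bc41, 2026-08-27T21:16:48Z,
evidence `HOME/REF1-data/b25/`): as-is rc 0, A1 rc 0 with `Iff.rfl` read-back, BC7 CLEAN ×4, `JointG7.lean` = tree parts 1–4 +
part 5 (39/39 decls SAME); verdicts `SquareLawAtTwo` SURVIVES (conjecture-grade, NOVEL-AS-STATED at 2 per REF2 v12),
`AnalyticSquareLawAtTwo` SURVIVES, `KummerPrimeAtTwo` / `TwoSaturatedPointAtTwo` SURVIVE (support) — «file as typed». REF1 trap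
T20 «2-divisibility entanglement» (recorded, not a kill): when `ℚ(½P) ⊂ ℚ(E[4])` (possible since `H¹(GL₂(ℤ/4), E[2]) = ℤ/2`;
302/15 639 rank-1 odd-torsion curves with `N < 10⁴`, all with an additive prime) every τ-prime of level `≥ 2` has
`d_ℓ(P) = 0`, so the law predicts `v₂ δ'_k(ℓ) = min(k, s+1)` with NO censoring there — confirmed on 30 entangled curves
(kit j290232: 1 405/1 405 uncensored tests, `d = 0` at 1 064/1 064 level-≥2 τ-primes `ℓ < 2 500`); the prose heuristic
«P(offset = 2j) = 2^{−(j+1)}» above holds for unentangled `(E, P)` only; `Odd W.tamagawaProduct` is load-bearing (42 ∏c-even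
controls all off the law). PARTITION: none moved; beyond-print theorem: no.
bears_on: `stmt-BirchSwinnertonDyer-19099` `RankOneAtTwo` (K2-F line; crux idea evidence e51bf75a04ed5752).
-/

noncomputable section

open scoped Classical MatrixGroups ModularForm

open CongruenceSubgroup WeierstrassCurve Literature.NumberTheory.EllipticCurves
  Literature.NumberTheory.EllipticCurves.ModularForms NumberField

namespace Summit.BirchSwinnertonDyer.Rank1Residual.F1Sign2


/-! ## K2-F♯ — the SQUARE (tame-height) LAW behind K2-F: `v₂ δ'_k(ℓ) = min(k, s + 1 + 2·d_ℓ(P))` -/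

section SquareLaw

/-- `P ∈ 2^j · E(ℚ_ℓ)`: local `2^j`-divisibility at `ℓ` of a rational point (for `ℓ ∤ 2N` this is
`P̃ ∈ 2^j · Ẽ(𝔽_ℓ)` by Hensel; at a level-`k` `τ`-prime `Ẽ(𝔽_ℓ)[2^∞]` is cyclic of order `≥ 2^k`, so
`d_ℓ(P) := max {j | P ∈ 2^j E(ℚ_ℓ)}` is the exact `2`-divisibility depth of `P̃`, `= ∞` iff the
`2`-primary component of `P̃` vanishes). A predicate (definition with a body), not a fact. [folklore] -/
def LocallyTwoPowDivisible (W : WeierstrassCurve ℚ) (ℓ : ℕ) [Fact ℓ.Prime] (j : ℕ)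
    (P : (W.toAffine.baseChange ℚ).Point) : Prop :=
  ∃ Q : (W.toAffine.baseChange ℚ_[ℓ]).Point,
    2 ^ j • Q = WeierstrassCurve.Affine.Point.baseChange (W' := W.toAffine) ℚ ℚ_[ℓ] P

/-- **K2-F♯ (candidate crux; conjecture NEW): the square law for first-layer Kurihara numbers at two in
rank one.**  Setting of K2-F (`E/ℚ` globally minimal, newform `f` with the period transfer at `2`,
`ρ_{E,2^∞}` onto, odd torsion, odd Tamagawa product, `w = −1`, rank `1`, `#Ш[2^∞] = 2^s`), `P ∈ E(ℚ)`
non-torsion with `P ∉ 2E(ℚ)` (odd index in `E(ℚ)/tors`), `ℓ` a level-`k` `τ`-prime, `ψ : (ℤ/ℓ)ˣ ↠ ℤ/2^k`.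
CLAIM: `v₂(δ'_k(ℓ; ψ) mod 2^k) = min(k, s + 1 + 2·d_ℓ(P))`, stated as: `P ∈ 2^j E(ℚ_ℓ) ⟹ δ' ∈
2^{min(k, s+1+2j)} ℤ_{(2)}` and `P ∉ 2^{j+1} E(ℚ_ℓ), s + 2 + 2j ≤ k ⟹ δ' ∉ 2^{s+2+2j} ℤ_{(2)}`.
MECHANISM (odd-`p` heuristic, every input printed for `p` odd only): `δ_ℓ = exp*_p(loc_p κ_ℓ)` (Kato's
reciprocity law for the Kolyvagin–Kurihara derivative class), `loc^s_ℓ κ_ℓ = φ^{fs}_ℓ(loc_ℓ κ_1)`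
(Kolyvagin; `φ^{fs} = Frob_ℓ^{-1} − 1` an isomorphism of cyclic `ℤ/2^k`'s at these primes, Kurihara 2014
§3), Poitou–Tate for `κ_ℓ ∪ P`: `δ_ℓ · c_p(P) + β_ℓ · c_ℓ(κ_1) · c_ℓ(P) = 0`, and `κ_1 = t·P` in
`H¹(ℚ, T₂E) = E(ℚ) ⊗ ℤ₂` (rank one, `Ш[2^∞]` finite) — so `δ_ℓ ≐ t·β_ℓ·c_ℓ(P)²/c_p(P)`: the local Kummer
coordinate `c_ℓ(P) ∈ E(ℚ_ℓ)/2^k ≅ ℤ/2^k` enters SQUARED, `v₂ c_ℓ(P) = d_ℓ(P)`, and `v₂(t/c_p(P)) = s`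
(`2`-adic BSD leading term); equivalently Mazur–Tate 1987 Conj. 4 at prime level in rank one,
`θ'_ℓ = #Ш · ⟨P,P⟩^{MT}_ℓ · (corr.)`, with the Mazur–Tate pairing a local bilinear form on the cyclic
`E(ℚ_ℓ)/2^k`.  Consequences: K2-F (a) (take `j = 0`); K2-F (b) ⟸ `KummerPrimeAtTwo` (a deep `τ`-prime
with `P̃ ∉ 2Ẽ(𝔽_ℓ)`, Chebotarev in `ℚ(E[2^k], ½P)`): `firstLayerLawAtTwo_of_squareLaw`.
BC5 witness: DES9-v1 odd-offset law (`v₂ δ' − (s+1)` even or censored on 6 782/6 782 rows, 2 877 deep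
enough to fail) and the ROW-LEVEL test DES10 (kit j288175 `des10-full2`: `d_ℓ(P)` from a `2`-saturated
PARI `ellheegner` generator, engine 1 Sage `GF(ℓ)` group law, engine 2 PARI `ellcard`/`ellorder`, against
the DES9-v1 valuations, tolerance zero): 310 curves, 13 541 `τ`-prime rows, **28 726 / 28 726** level
checks `2^j ∣ δ'_j ⟺ j ≤ min(k, s+1+2d)` hold, of which **3 787 / 3 787 UNCENSORED** (the law predicts the
exact valuation `< j` and is right: R1S1 2 084, R1S4 952, R1S25 404, R1S9 347); engine disagreements 0,
`a_ℓ` mismatches 0, `#Ẽ(𝔽_ℓ)[2] = 2` on 13 541/13 541; `d` geometric(1/2) as Chebotarev predicts (rows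
with `2^5 ∣ #Ẽ(𝔽_ℓ)`: `d = 0/1/2/3/≥4` = 1 086/554/261/119/116); Heegner-point halvings = `√#Ш_an`
exactly (0 on the 98 `s = 0` curves, 1 on the 191 `#Ш_an = 4`, 2 on the 21 `#Ш_an = 16`); K2-F (b)
via a Kummer prime (`d = 0` at a level `≥ s+2`) on 286/286 testable curves (MEMO-es §12).
Why it might fail: the unit `β_ℓ` of the finite/singular comparison could acquire a `2`-adic valuation
on a sub-class of `τ`-primes at `2` (e.g. `ℓ ≡ 1 (2^{k+1})` vs `≡ 1 + 2^k`), or `v₂(t / c_2(P))` could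
depend on `E(ℚ₂)[2]` / `c_∞`; either shows as a systematic offset in DES10.
Cheapest falsifier: ONE DES10 row with engines agreeing and `v_obs ≠ min(k, s_an + 1 + 2d)`.
Sources: Kurihara arXiv:1407.2465 §1.2, §3 (`𝒫₁^{(N)}`, `φ_ℓ`); Kim arXiv:2203.12159 Thm 1.1;
Mazur–Tate, Duke 54 (1987) Conj. 4; Bertolini–Darmon, Duke 76 (1994) (derived heights);
Mazur–Rubin, Mem. AMS 799 (2004) (finite–singular map). REF2 v12 §1: NOVEL-AS-STATED at `2`; the per-`ℓ` valuation
sentence is printed at no `p` (odd `p ≥ 5`: in-print-assembly corollary-grade); habitat [cite: MazurTate1987, Conj. 4]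
[cite: Kurihara2014, Thm. 1.2.3, Conj. 1.2.4] [cite: Kim2022, Thm. 1.1] [cite: BertoliniDarmon1994, Conj. 4.6, Rem. 1]. -/
@[conjecture] def SquareLawAtTwo : Prop :=
  ∀ (W : WeierstrassCurve ℚ) [W.IsElliptic] [W.IsGloballyMinimal] {M : ℕ} [NeZero M]
    (f : CuspForm (Gamma0 M) 2), IsNewformOf W f → PeriodTransferAtTwo W f →
    (∀ n : ℕ, W.HasSurjectiveModNGaloisRep ((2 ^ n : ℕ) : ℤ)) → Odd W.torsionOrder → Odd W.tamagawaProduct →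
    W.rootNumber = -1 → W.mordellWeilRank = 1 → Finite (AddCommGroup.primaryComponent W.sha 2) →
    ∀ P : (W.toAffine.baseChange ℚ).Point, (∀ n : ℕ, n ≠ 0 → n • P ≠ 0) →
      (∀ Q : (W.toAffine.baseChange ℚ).Point, 2 • Q ≠ P) →
    let s := padicValNat 2 (Nat.card (AddCommGroup.primaryComponent W.sha 2))
    ∀ (ℓ k j : ℕ) [Fact ℓ.Prime], IsLevelAtTwo W ℓ → 1 ≤ k → (2 ^ k : ℤ) ∣ (ℓ : ℤ) - 1 →
      (2 ^ k : ℤ) ∣ W.frobeniusTrace ℓ - 2 →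
      ∀ ψ : (ZMod ℓ)ˣ →* Multiplicative (ZMod (2 ^ k)), Function.Surjective ψ →
        (LocallyTwoPowDivisible W ℓ j P → InTwoPowZLoc (min k (s + 1 + 2 * j)) (levelSumTwo f ℓ k ψ)) ∧
        (¬ LocallyTwoPowDivisible W ℓ (j + 1) P → s + 2 + 2 * j ≤ k →
          ¬ InTwoPowZLoc (s + 2 + 2 * j) (levelSumTwo f ℓ k ψ))

/-- **K2-F♯ modulo BSD₂ = the ANALYTIC square law (support / data form; what DES10 literally tests):**
the same with analytic rank `1` and `s_an := v₂(#Ш_an)` (`shaAn W = q`). -/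
@[conjecture] def AnalyticSquareLawAtTwo : Prop :=
  ∀ (W : WeierstrassCurve ℚ) [W.IsElliptic] [W.IsGloballyMinimal] {M : ℕ} [NeZero M]
    (f : CuspForm (Gamma0 M) 2), IsNewformOf W f → PeriodTransferAtTwo W f →
    (∀ n : ℕ, W.HasSurjectiveModNGaloisRep ((2 ^ n : ℕ) : ℤ)) → Odd W.torsionOrder → Odd W.tamagawaProduct →
    W.rootNumber = -1 → W.analyticRank = 1 →
    ∀ q : ℚ, shaAn W = (q : ℂ) → q ≠ 0 →
    ∀ P : (W.toAffine.baseChange ℚ).Point, (∀ n : ℕ, n ≠ 0 → n • P ≠ 0) →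
      (∀ Q : (W.toAffine.baseChange ℚ).Point, 2 • Q ≠ P) →
    let s := (padicValRat 2 q).toNat
    ∀ (ℓ k j : ℕ) [Fact ℓ.Prime], IsLevelAtTwo W ℓ → 1 ≤ k → (2 ^ k : ℤ) ∣ (ℓ : ℤ) - 1 →
      (2 ^ k : ℤ) ∣ W.frobeniusTrace ℓ - 2 →
      ∀ ψ : (ZMod ℓ)ˣ →* Multiplicative (ZMod (2 ^ k)), Function.Surjective ψ →
        (LocallyTwoPowDivisible W ℓ j P → InTwoPowZLoc (min k (s + 1 + 2 * j)) (levelSumTwo f ℓ k ψ)) ∧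
        (¬ LocallyTwoPowDivisible W ℓ (j + 1) P → s + 2 + 2 * j ≤ k →
          ¬ InTwoPowZLoc (s + 2 + 2 * j) (levelSumTwo f ℓ k ψ))

/-- **support (KUM) `KummerPrimeAtTwo` — Kummer primes at two (a Chebotarev statement; IN-PRINT-ASSEMBLY routine per
REF2 v12 §0: Kummer theory of non-CM curves, Bashmakov / Ribet, + Chebotarev; threaded as an explicit hypothesis of the
glue theorems below, not asserted):** for `E` with `ρ_{E,2^∞}` onto and
`P ∈ E(ℚ)` non-torsion with `P ∉ 2E(ℚ)`, there are `τ`-primes of arbitrarily deep level at which `P̃`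
is NOT divisible by `2` (Frobenius in `Gal(ℚ(E[2^k], ½P)/ℚ)` unipotent-type on `E[2^k]` with cyclic
fixed space and moving the halves of `P`; Bashmakov / Lang–Trotter Kummer theory for non-CM curves). [folklore] -/
def KummerPrimeAtTwo : Prop :=
  ∀ (W : WeierstrassCurve ℚ) [W.IsElliptic] [W.IsGloballyMinimal],
    (∀ n : ℕ, W.HasSurjectiveModNGaloisRep ((2 ^ n : ℕ) : ℤ)) →
    ∀ P : (W.toAffine.baseChange ℚ).Point, (∀ n : ℕ, n ≠ 0 → n • P ≠ 0) →
      (∀ Q : (W.toAffine.baseChange ℚ).Point, 2 • Q ≠ P) →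
    ∀ K : ℕ, ∃ (ℓ k : ℕ) (_ : Fact ℓ.Prime) (ψ : (ZMod ℓ)ˣ →* Multiplicative (ZMod (2 ^ k))),
      IsLevelAtTwo W ℓ ∧ K ≤ k ∧ 1 ≤ k ∧ (2 ^ k : ℤ) ∣ (ℓ : ℤ) - 1 ∧ (2 ^ k : ℤ) ∣ W.frobeniusTrace ℓ - 2 ∧
      Function.Surjective ψ ∧ ¬ LocallyTwoPowDivisible W ℓ 1 P

/-- **support (2SAT) `TwoSaturatedPointAtTwo` — two-saturated points (Mordell–Weil; THEOREM, trivial given a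
Mordell–Weil basis per REF2 v12 §0; threaded as an explicit hypothesis of the glue theorems below, not asserted):** a
rank-one curve with odd torsion has a rational point of infinite order not divisible by `2` in `E(ℚ)` (any generator
modulo torsion). [folklore] -/
def TwoSaturatedPointAtTwo : Prop :=
  ∀ (W : WeierstrassCurve ℚ) [W.IsElliptic], W.mordellWeilRank = 1 → Odd W.torsionOrder →
    ∃ P : (W.toAffine.baseChange ℚ).Point, (∀ n : ℕ, n ≠ 0 → n • P ≠ 0) ∧
      ∀ Q : (W.toAffine.baseChange ℚ).Point, 2 • Q ≠ P

/-- `P ∈ 2^0 · E(ℚ_ℓ)` always. -/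
theorem locallyTwoPowDivisible_zero (W : WeierstrassCurve ℚ) (ℓ : ℕ) [Fact ℓ.Prime]
    (P : (W.toAffine.baseChange ℚ).Point) : LocallyTwoPowDivisible W ℓ 0 P :=
  ⟨WeierstrassCurve.Affine.Point.baseChange (W' := W.toAffine) ℚ ℚ_[ℓ] P, by simp⟩

/-- **Glue: the square law, Kummer primes and Mordell–Weil give K2-F.**  (a) is the case `j = 0` of the
square law; (b) is its second clause at `j = 0` on a Kummer prime of level `≥ s + 2`. -/
theorem firstLayerLawAtTwo_of_squareLaw (hS : SquareLawAtTwo) (hK : KummerPrimeAtTwo)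
    (hMW : TwoSaturatedPointAtTwo) : FirstLayerLawAtTwo := by
  intro W _ _ M _ f hf hper hsurj hT hc hw hr hfin
  obtain ⟨P, hP1, hP2⟩ := hMW W hr hT
  have hSW := hS W f hf hper hsurj hT hc hw hr hfin P hP1 hP2
  refine ⟨?_, ?_⟩
  · intro ℓ k _ hlev hk hl ha ψ hψ
    have h := (hSW ℓ k 0 hlev hk hl ha ψ hψ).1 (locallyTwoPowDivisible_zero W ℓ P)
    simpa using h
  · obtain ⟨ℓ, k, hℓ, ψ, hlev, hKk, hk, hl, ha, hψ, hndiv⟩ :=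
      hK W hsurj P hP1 hP2 (padicValNat 2 (Nat.card (AddCommGroup.primaryComponent W.sha 2)) + 2)
    refine ⟨ℓ, k, hℓ, ψ, hlev, hKk, hl, ha, hψ, ?_⟩
    have h := (hSW ℓ k 0 hlev hk hl ha ψ hψ).2 (by simpa using hndiv) (by simpa using hKk)
    simpa using h

/-- The analytic square law and the same two supports give the analytic first-layer law K2-F_an. -/
theorem analyticFirstLayerLawAtTwo_of_squareLaw (hS : AnalyticSquareLawAtTwo) (hK : KummerPrimeAtTwo)
    (hMW : TwoSaturatedPointAtTwo) (hGZK : rank_eq_analyticRank_of_analyticRank_le_one) :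
    AnalyticFirstLayerLawAtTwo := by
  intro W _ _ M _ f hf hper hsurj hT hc hw han q hq hq0
  have hr : W.mordellWeilRank = 1 := by
    have h := (hGZK W (by rw [han])).1
    rw [h, han]
  obtain ⟨P, hP1, hP2⟩ := hMW W hr hT
  have hSW := hS W f hf hper hsurj hT hc hw han q hq hq0 P hP1 hP2
  refine ⟨?_, ?_⟩
  · intro ℓ k _ hlev hk hl ha ψ hψ
    have h := (hSW ℓ k 0 hlev hk hl ha ψ hψ).1 (locallyTwoPowDivisible_zero W ℓ P)
    simpa using h
  · obtain ⟨ℓ, k, hℓ, ψ, hlev, hKk, hk, hl, ha, hψ, hndiv⟩ :=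
      hK W hsurj P hP1 hP2 ((padicValRat 2 q).toNat + 2)
    refine ⟨ℓ, k, hℓ, ψ, hlev, hKk, hl, ha, hψ, ?_⟩
    have h := (hSW ℓ k 0 hlev hk hl ha ψ hψ).2 (by simpa using hndiv) (by simpa using hKk)
    simpa using h

end SquareLaw

end Summit.BirchSwinnertonDyer.Rank1Residual.F1Sign2
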